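import Literature.MathematicalPhysics.QuantumFieldTheory.Balaban1983to89.Node00.OpsYOfLetters

/-!
# `Balaban1983to89.B9Cor35AtOneInverseLetters` — [B9] Cor. 3.5 p. 407 at `U = 1` for letters DEFINED AS INVERSES: the interface clauses
# `CovLettersY.GA_one` (G(U) = Δ_a(U)⁻¹, Theorem 3.3) and `CovLettersY.Gp_one` (G′(U) = Δ′_a(U)⁻¹, Theorem 3.1) FROM the printed `U = 1`
# identification of the DIRECT operators on product-form arguments (p. 395 «It coincides with Δ_a in (2.19) if U = 1»)

B9 = T. Bałaban, *Propagators for lattice gauge theories in a background field*, Commun. Math. Phys. **99** (1985) 389–434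
[Balaban1985BackgroundPropagators]; [4] = B6 = T. Bałaban, *Propagators and renormalization transformations for lattice gauge theories. II*,
Commun. Math. Phys. **96** (1984) 223–250 [Balaban1984PropagatorsII].

statement-level skeleton of published theorems with citation tags; proofs where landed; nothing here is a claim about the Yang–Mills mass gap

THE PRINTED LOCI.  p. 395, after (3.26)–(3.27): *"Let us denote by Δ_a(U) the operator determined by the quadratic form in A in the above
expression. It coincides with Δ_a in (2.19) [of [4]] if U = 1. … G(U) = Δ_a(U)⁻¹"*; p. 394–395, (3.24)–(3.25): *"Δ′_a(U) … G′(U) = Δ′_a(U)⁻¹"*;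
p. 407, proof of Corollary 3.5: *"There we have proved these theorems for operators with the external gauge field configuration U = 1."*;
[4] (2.19) p. 226 `Δ_a = ∂*∂ + ∂R∂* + Q*aQ`, (2.22) `G = Δ_a⁻¹` (r03's `B6SectAVectorModelV1.deltaAE ∕ GE`, read on bond functions through
`B6Ineq2133TwoScaleV1.onFun`; `B6Prop26Census2136KLevelV1.Gop i = onFun (GE …)`); [4] (2.13)–(2.14) p. 225 `Δ′_a`, `G′ = Δ′_a⁻¹` (T1's
`B6MultiLevelTorusOperator.mlOpT ∕ gmlT`; NODE 00's `KTIdx.G = gmlT … (aPrinted ℓ 1)`).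

THE POINT.  NODE 00 def-Y's letter interface `Node00.CovLettersY x` (p464552) types Bałaban's `U`-dependent operators with the printed `U = 1`
clauses as `Prop` FIELDS: `GA_one : ∀ J E, GA 1 (J ⊗ E) = (Gop i J) ⊗ E` and `Gp_one : ∀ f E, Gp 1 (f ⊗ E) = (KTIdx.G *ᵥ f) ⊗ E` (`J ⊗ E =
Node00.liftY J E`, the product-form lift along a direction `E ∈ 𝔸`).  The five `U = 1` comparison rows `hGA_e … hGA_l2` of the N06 certificate are
proved FROM `GA_one` for every letter family (`B9Cor35ComparisonsGAAtLetters`, p468508); what remains UNDER them is the clause itself for the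
CONSTRUCTED letter.  Bałaban's G(U) and G′(U) are INVERSES (`G(U) = Δ_a(U)⁻¹`, `G′(U) = Δ′_a(U)⁻¹`; def-Y's v2 memo: `GA U := Ring.inverse (Δ_a(U))`
in `Module.End ℂ (bonds → 𝔸)`), and print states the `U = 1` identification for the DIRECT operators («It coincides with Δ_a in (2.19) if U = 1»).
THIS FILE is the kernel algebra that turns the latter into the former, once, for any carrier:
* §1 PRODUCT-FORM LIFTS SPAN: `Λ = Σ_w δ_w ⊗ Λ(w)` (`sum_liftY_indicator`), hence two ℂ-linear maps out of `X → 𝔸` that agree on every `f ⊗ E`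
  are equal (`linearMap_ext_of_liftY`) — the memo's `liftY_span`.
* §2 THE LIFT IS A UNITAL ALGEBRA MAP: `liftOpY_one`, `liftOpY_mul`, `liftEndY_id`, `liftEndY_comp`; units lift to units (`isUnit_liftOpY`,
  `isUnit_liftEndY`); an operator satisfying a product-form clause IS the lift (`eq_liftOpY_of_liftY`, `eq_liftEndY_of_liftY`) and is a unit when the
  model operator is (`isUnit_of_liftY_clause(_mulVec)`).
* §3 CLAUSE TRANSFER THROUGH AN INVERSE (generic carrier `X`, generic `𝔸`): if `O₁ ∘ Δ₁ = id`, the model operators satisfy `T ∘ S = id`, and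
  `Δ₁ (f ⊗ E) = (T f) ⊗ E` for all `f, E`, then `O₁ (f ⊗ E) = (S f) ⊗ E` (`clause_of_leftInverse`, five lines, no finiteness; matrix form
  `clause_of_leftInverse_mulVec`); the `Ring.inverse` forms (`inverse_comp_self_of_liftY_clause`, `clause_of_ringInverse(_mulVec)`) need no
  separate invertibility hypothesis on `Δ₁`: it is a unit BECAUSE it lifts a unit.
* §4 NODE 00's LETTERS: ★ `GA_one_of_deltaA_one` — for any bond-sector letters `O Δ : BondOpY 𝔸 i` with `O 1 ∘ₗ Δ 1 = id` and the printed clause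
  `Δ 1 (A ⊗ E) = (onFun (deltaAE (domT i.hN i.D i.hk) i.cf i.w) A) ⊗ E` ([4] (2.19) on bond functions), the conclusion is THE TYPE OF
  `CovLettersY.GA_one` LITERALLY; ★ `GA_one_of_ringInverse_deltaA_one` (the memo's shape `O 1 = Ring.inverse (Δ 1)`); the site-sector twins
  ★ `Gp_one_of_deltaPrimeA_one` ∕ ★ `Gp_one_of_ringInverse_deltaPrimeA_one` (clause against T1's `mlOpT … (aPrinted ℓ 1)`, conclusion = the type of
  `CovLettersY.Gp_one`); and the operator-level identifications `eq_liftEndY_Gop_of_ringInverse` ∕ `eq_liftOpY_G_of_ringInverse` (at `U = 1` an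
  inverse letter IS the flat letter of `Node00.covLettersY_flat`).  Inputs BY NAME: r03's `B6OpTransposeV1.onFun_deltaAE_mul_GE`,
  `B6Prop26KLevelSkeletonV1.onFun_GE_mul_deltaAE`; T1's `B6Prop22MultiLevelTorus.gmlT_mul_mlOpT_pos`, `mlOpT_isUnit`.

HONEST SCOPE.  Kernel algebra of lifts and inverses; it REDUCES the interface's `U = 1` proof fields of inverse letters to the printed `U = 1`
identification of the direct operators Δ_a(U), Δ′_a(U) on product-form arguments — which, for Bałaban's operators CONSTRUCTED over the member's
domains ((3.10)–(3.27) with the covariant averages of [5]), is def-Y's successor item (`lettersYOfRecord`; memo OPS-LETTERS-CONSTRUCTION.md §2 step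
(a)) and is NOT proved here.  The third clause `C_one` ((Q′G′²Q′*)⁻¹ vs T8's `CinvTP`, normalisation `η^{4+(d+1)}·GinvT∕W`) is not treated.  No
estimate of print is asserted; count-neutral; N06 NOT discharged; one finite lattice programme; NOT continuum ∕ OS ∕ mass gap ∕ Clay.  No `def` ∕
`sorry` ∕ `axiom` ∕ `instance` ∕ `notation`.  Cell `pub-ymgap` (HUMAN RULING D-0062), Track A node N06, seat `pub-ymgap-dag-n06-g` g3 (bundle F2 of
dag-lead's N06-ASSIGNMENT v1, rows 4–8 one level below the letter interface), 2026-08-26.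
-/

namespace Literature.MathematicalPhysics.QuantumFieldTheory.Balaban1983to89.B9Cor35AtOneInverseLetters

open B6Ineq2133TwoScaleV1 (onFun)
open B6SectAVectorModelV1 (deltaAE GE)
open B6GlobalChartV1 (domT)
open B6KLevelCensusIndexV1 (KIdx)
open B6Prop26Census2136KLevelV1 (Gop)
open B6MultiLevelBoxOperator (aPrinted)
open B6MultiLevelTorusOperator (mlOpT gmlT mlOpT_isUnit one_le_N0)
open B6Prop23KLevelTorusCensus (aPrinted_pos)
open Node00 (liftY liftY_apply liftOpY liftOpY_liftY liftEndY liftEndY_liftY toKT SiteY FBondY CfgY SiteOpY BondOpY covLettersY_flat)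
open scoped Matrix

variable {𝔸 : Type} [NormedRing 𝔸] [NormedAlgebra ℂ 𝔸]

/-! ## §1 Product-form lifts span the `𝔸`-valued functions -/

section Span

variable {X : Type}

/-- the lift of the indicator of `w` along `E` is the `𝔸`-valued delta `δ_w ⊗ E`: value `E` at `w`, `0` elsewhere.
[cite: Balaban1985BackgroundPropagators, (3.39) p.397 (product-form arguments), bookkeeping] -/
theorem liftY_indicator_apply [DecidableEq X] (w : X) (E : 𝔸) (z : X) :
    liftY (fun z' => if z' = w then (1 : ℝ) else 0) E z = if z = w then E else 0 := by
  rw [liftY_apply]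
  split_ifs <;> simp

/-- **product-form lifts span**: every `𝔸`-valued function on a finite carrier is the sum of the lifts of the indicators along its values,
`Λ = Σ_w δ_w ⊗ Λ(w)`. [cite: Balaban1985BackgroundPropagators, (3.39) p.397 (𝔤-valued λ read through product forms), bookkeeping] -/
theorem sum_liftY_indicator [Fintype X] [DecidableEq X] (Λ : X → 𝔸) :
    ∑ w, liftY (fun z => if z = w then (1 : ℝ) else 0) (Λ w) = Λ := by
  funext z
  rw [Finset.sum_apply]
  simp_rw [liftY_indicator_apply]
  rw [Finset.sum_ite_eq]
  simp

/-- **two ℂ-linear maps out of `X → 𝔸` that agree on every product-form lift `f ⊗ E` are equal** (finite carrier `X`).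
[cite: Balaban1985BackgroundPropagators, (3.39) p.397, bookkeeping (the memo's `liftY_span`)] -/
theorem linearMap_ext_of_liftY [Fintype X] {M : Type*} [AddCommMonoid M] [Module ℂ M] {S T : (X → 𝔸) →ₗ[ℂ] M}
    (h : ∀ (f : X → ℝ) (E : 𝔸), S (liftY f E) = T (liftY f E)) : S = T := by
  classical
  refine LinearMap.ext fun Λ => ?_
  rw [← sum_liftY_indicator Λ, map_sum, map_sum]
  exact Finset.sum_congr rfl fun w _ => h _ _

end Span

/-! ## §2 The lift `A ↦ A♯` is a unital algebra map; units lift to units -/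

section Lift

variable (𝔸)
variable {X : Type} [Fintype X]

/-- `1♯ = id`. [cite: Balaban1985BackgroundPropagators, p.395 («It coincides with Δ_a in (2.19) if U = 1»), bookkeeping (lift calculus)] -/
theorem liftOpY_one [DecidableEq X] : liftOpY 𝔸 (1 : Matrix X X ℝ) = LinearMap.id :=
  linearMap_ext_of_liftY fun f E => by rw [liftOpY_liftY, Matrix.one_mulVec, LinearMap.id_apply]

/-- `(A·B)♯ = A♯ ∘ B♯`. [cite: Balaban1985BackgroundPropagators, p.395 («It coincides with Δ_a in (2.19) if U = 1»), bookkeeping (lift calculus)] -/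
theorem liftOpY_mul (A B : Matrix X X ℝ) : liftOpY 𝔸 (A * B) = liftOpY 𝔸 A ∘ₗ liftOpY 𝔸 B :=
  linearMap_ext_of_liftY fun f E => by
    rw [LinearMap.comp_apply, liftOpY_liftY, liftOpY_liftY, liftOpY_liftY, Matrix.mulVec_mulVec]

/-- the lift of the identity endomorphism is the identity. [cite: Balaban1985BackgroundPropagators, p.395, bookkeeping (lift calculus)] -/
theorem liftEndY_id [DecidableEq X] : liftEndY 𝔸 (LinearMap.id : Module.End ℝ (X → ℝ)) = LinearMap.id := by
  rw [liftEndY, LinearMap.toMatrix'_id, liftOpY_one]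

/-- the lift of a composite is the composite of the lifts. [cite: Balaban1985BackgroundPropagators, p.395, bookkeeping (lift calculus)] -/
theorem liftEndY_comp [DecidableEq X] (S T : Module.End ℝ (X → ℝ)) :
    liftEndY 𝔸 (S ∘ₗ T) = liftEndY 𝔸 S ∘ₗ liftEndY 𝔸 T := by
  rw [liftEndY, LinearMap.toMatrix'_comp, liftOpY_mul]
  rfl

/-- a unit of the real matrix ring lifts to a unit of `Module.End ℂ (X → 𝔸)`. [cite: Balaban1985BackgroundPropagators, pp.394–395 («G′(U) = Δ′_a(U)⁻¹»), bookkeeping (lift calculus)] -/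
theorem isUnit_liftOpY [DecidableEq X] {A : Matrix X X ℝ} (hA : IsUnit A) : IsUnit (liftOpY 𝔸 A) := by
  obtain ⟨u, rfl⟩ := hA
  refine ⟨⟨liftOpY 𝔸 (u : Matrix X X ℝ), liftOpY 𝔸 (↑u⁻¹ : Matrix X X ℝ), ?_, ?_⟩, rfl⟩
  · rw [Module.End.mul_eq_comp, ← liftOpY_mul, Units.mul_inv, liftOpY_one, Module.End.one_eq_id]
  · rw [Module.End.mul_eq_comp, ← liftOpY_mul, Units.inv_mul, liftOpY_one, Module.End.one_eq_id]

/-- a unit of `Module.End ℝ (X → ℝ)` lifts to a unit of `Module.End ℂ (X → 𝔸)`. [cite: Balaban1985BackgroundPropagators, p.395 («G(U) = Δ_a(U)⁻¹»), bookkeeping (lift calculus)] -/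
theorem isUnit_liftEndY [DecidableEq X] {T : Module.End ℝ (X → ℝ)} (hT : IsUnit T) : IsUnit (liftEndY 𝔸 T) := by
  obtain ⟨u, rfl⟩ := hT
  refine ⟨⟨liftEndY 𝔸 (u : Module.End ℝ (X → ℝ)), liftEndY 𝔸 (↑u⁻¹ : Module.End ℝ (X → ℝ)), ?_, ?_⟩, rfl⟩
  · rw [Module.End.mul_eq_comp, ← liftEndY_comp, ← Module.End.mul_eq_comp, Units.mul_inv, Module.End.one_eq_id (R := ℝ), liftEndY_id,
      Module.End.one_eq_id (R := ℂ)]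
  · rw [Module.End.mul_eq_comp, ← liftEndY_comp, ← Module.End.mul_eq_comp, Units.inv_mul, Module.End.one_eq_id (R := ℝ), liftEndY_id,
      Module.End.one_eq_id (R := ℂ)]

variable {𝔸}

/-- **an operator with a product-form clause IS the lift** (matrix form): `(∀ f E, Δ₁ (f ⊗ E) = (M f) ⊗ E) → Δ₁ = M♯`.
[cite: Balaban1985BackgroundPropagators, p.395 («It coincides with Δ_a in (2.19) if U = 1»), bookkeeping] -/
theorem eq_liftOpY_of_liftY {Δ₁ : (X → 𝔸) →ₗ[ℂ] (X → 𝔸)} {M : Matrix X X ℝ}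
    (hΔ : ∀ (f : X → ℝ) (E : 𝔸), Δ₁ (liftY f E) = liftY (M *ᵥ f) E) : Δ₁ = liftOpY 𝔸 M :=
  linearMap_ext_of_liftY fun f E => by rw [hΔ, liftOpY_liftY]

/-- **an operator with a product-form clause IS the lift** (endomorphism form): `(∀ f E, Δ₁ (f ⊗ E) = (T f) ⊗ E) → Δ₁ = liftEndY T`.
[cite: Balaban1985BackgroundPropagators, p.395 («It coincides with Δ_a in (2.19) if U = 1»), bookkeeping] -/
theorem eq_liftEndY_of_liftY [DecidableEq X] {Δ₁ : (X → 𝔸) →ₗ[ℂ] (X → 𝔸)} {T : Module.End ℝ (X → ℝ)}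
    (hΔ : ∀ (f : X → ℝ) (E : 𝔸), Δ₁ (liftY f E) = liftY (T f) E) : Δ₁ = liftEndY 𝔸 T :=
  linearMap_ext_of_liftY fun f E => by rw [hΔ, liftEndY_liftY]

/-- an operator with a product-form clause against a UNIT matrix is a unit. [cite: Balaban1985BackgroundPropagators, p.395, bookkeeping] -/
theorem isUnit_of_liftY_clause_mulVec [DecidableEq X] {Δ₁ : (X → 𝔸) →ₗ[ℂ] (X → 𝔸)} {M : Matrix X X ℝ} (hM : IsUnit M)
    (hΔ : ∀ (f : X → ℝ) (E : 𝔸), Δ₁ (liftY f E) = liftY (M *ᵥ f) E) : IsUnit Δ₁ := by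
  rw [eq_liftOpY_of_liftY hΔ]
  exact isUnit_liftOpY 𝔸 hM

/-- an operator with a product-form clause against a UNIT endomorphism is a unit. [cite: Balaban1985BackgroundPropagators, p.395, bookkeeping] -/
theorem isUnit_of_liftY_clause [DecidableEq X] {Δ₁ : (X → 𝔸) →ₗ[ℂ] (X → 𝔸)} {T : Module.End ℝ (X → ℝ)} (hT : IsUnit T)
    (hΔ : ∀ (f : X → ℝ) (E : 𝔸), Δ₁ (liftY f E) = liftY (T f) E) : IsUnit Δ₁ := by
  rw [eq_liftEndY_of_liftY hΔ]
  exact isUnit_liftEndY 𝔸 hT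

end Lift

/-! ## §3 Clause transfer through an inverse -/

section Transfer

variable {X : Type}

/-- **CLAUSE TRANSFER THROUGH A LEFT INVERSE** (endomorphism form): if `O₁ ∘ Δ₁ = id`, the model operators satisfy `T ∘ S = id`, and `Δ₁` acts on
product forms as `T` (`Δ₁ (f ⊗ E) = (T f) ⊗ E`), then `O₁` acts on product forms as `S`: `O₁ (f ⊗ E) = O₁ (Δ₁ ((S f) ⊗ E)) = (S f) ⊗ E`.
[cite: Balaban1985BackgroundPropagators, p.395 («G(U) = Δ_a(U)⁻¹ … coincides with Δ_a in (2.19) if U = 1») + Cor. 3.5 p.407, bookkeeping (derivation ours)] -/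
theorem clause_of_leftInverse {O₁ Δ₁ : (X → 𝔸) →ₗ[ℂ] (X → 𝔸)} {T S : Module.End ℝ (X → ℝ)}
    (hinv : O₁ ∘ₗ Δ₁ = LinearMap.id) (hTS : T ∘ₗ S = LinearMap.id)
    (hΔ : ∀ (f : X → ℝ) (E : 𝔸), Δ₁ (liftY f E) = liftY (T f) E) (f : X → ℝ) (E : 𝔸) :
    O₁ (liftY f E) = liftY (S f) E := by
  have h1 : T (S f) = f := LinearMap.congr_fun hTS f
  have h2 : O₁ (Δ₁ (liftY (S f) E)) = liftY (S f) E := LinearMap.congr_fun hinv (liftY (S f) E)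
  rw [hΔ, h1] at h2
  exact h2

/-- **CLAUSE TRANSFER THROUGH A LEFT INVERSE** (matrix form): `O₁ ∘ Δ₁ = id`, `M·G = 1`, `Δ₁ (f ⊗ E) = (M f) ⊗ E` ⊢ `O₁ (f ⊗ E) = (G f) ⊗ E`.
[cite: Balaban1985BackgroundPropagators, pp.394–395 («G′(U) = Δ′_a(U)⁻¹») + Cor. 3.5 p.407, bookkeeping (derivation ours)] -/
theorem clause_of_leftInverse_mulVec [Fintype X] [DecidableEq X] {O₁ Δ₁ : (X → 𝔸) →ₗ[ℂ] (X → 𝔸)} {M G : Matrix X X ℝ}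
    (hinv : O₁ ∘ₗ Δ₁ = LinearMap.id) (hMG : M * G = 1)
    (hΔ : ∀ (f : X → ℝ) (E : 𝔸), Δ₁ (liftY f E) = liftY (M *ᵥ f) E) (f : X → ℝ) (E : 𝔸) :
    O₁ (liftY f E) = liftY (G *ᵥ f) E := by
  have h1 : M *ᵥ (G *ᵥ f) = f := by rw [Matrix.mulVec_mulVec, hMG, Matrix.one_mulVec]
  have h2 : O₁ (Δ₁ (liftY (G *ᵥ f) E)) = liftY (G *ᵥ f) E := LinearMap.congr_fun hinv (liftY (G *ᵥ f) E)
  rw [hΔ, h1] at h2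
  exact h2

/-- the `Ring.inverse` of an operator with a product-form clause against a unit endomorphism is a left inverse (`Ring.inverse Δ₁ ∘ Δ₁ = id`) —
no invertibility hypothesis on `Δ₁` itself. [cite: Balaban1985BackgroundPropagators, p.395 («G(U) = Δ_a(U)⁻¹»), bookkeeping] -/
theorem inverse_comp_self_of_liftY_clause [Fintype X] [DecidableEq X] {Δ₁ : (X → 𝔸) →ₗ[ℂ] (X → 𝔸)} {T : Module.End ℝ (X → ℝ)}
    (hT : IsUnit T) (hΔ : ∀ (f : X → ℝ) (E : 𝔸), Δ₁ (liftY f E) = liftY (T f) E) :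
    Ring.inverse Δ₁ ∘ₗ Δ₁ = LinearMap.id := by
  have h := Ring.inverse_mul_cancel Δ₁ (isUnit_of_liftY_clause hT hΔ)
  rwa [Module.End.mul_eq_comp, Module.End.one_eq_id] at h

/-- matrix form of `inverse_comp_self_of_liftY_clause`. [cite: Balaban1985BackgroundPropagators, pp.394–395 («G′(U) = Δ′_a(U)⁻¹»), bookkeeping] -/
theorem inverse_comp_self_of_liftY_clause_mulVec [Fintype X] [DecidableEq X] {Δ₁ : (X → 𝔸) →ₗ[ℂ] (X → 𝔸)} {M : Matrix X X ℝ}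
    (hM : IsUnit M) (hΔ : ∀ (f : X → ℝ) (E : 𝔸), Δ₁ (liftY f E) = liftY (M *ᵥ f) E) :
    Ring.inverse Δ₁ ∘ₗ Δ₁ = LinearMap.id := by
  have h := Ring.inverse_mul_cancel Δ₁ (isUnit_of_liftY_clause_mulVec hM hΔ)
  rwa [Module.End.mul_eq_comp, Module.End.one_eq_id] at h

/-- **CLAUSE TRANSFER THROUGH `Ring.inverse`** (endomorphism form): `O₁ = Ring.inverse Δ₁`, `T` a unit with `T ∘ S = id`, `Δ₁ (f ⊗ E) = (T f) ⊗ E`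
⊢ `O₁ (f ⊗ E) = (S f) ⊗ E`. [cite: Balaban1985BackgroundPropagators, p.395 + Cor. 3.5 p.407, bookkeeping (derivation ours)] -/
theorem clause_of_ringInverse [Fintype X] [DecidableEq X] {O₁ Δ₁ : (X → 𝔸) →ₗ[ℂ] (X → 𝔸)} {T S : Module.End ℝ (X → ℝ)}
    (hO : O₁ = Ring.inverse Δ₁) (hT : IsUnit T) (hTS : T ∘ₗ S = LinearMap.id)
    (hΔ : ∀ (f : X → ℝ) (E : 𝔸), Δ₁ (liftY f E) = liftY (T f) E) (f : X → ℝ) (E : 𝔸) :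
    O₁ (liftY f E) = liftY (S f) E :=
  clause_of_leftInverse (by rw [hO]; exact inverse_comp_self_of_liftY_clause hT hΔ) hTS hΔ f E

/-- **CLAUSE TRANSFER THROUGH `Ring.inverse`** (matrix form): `O₁ = Ring.inverse Δ₁`, `M·G = 1`, `Δ₁ (f ⊗ E) = (M f) ⊗ E` ⊢ `O₁ (f ⊗ E) = (G f) ⊗ E`.
[cite: Balaban1985BackgroundPropagators, pp.394–395 + Cor. 3.5 p.407, bookkeeping (derivation ours)] -/
theorem clause_of_ringInverse_mulVec [Fintype X] [DecidableEq X] {O₁ Δ₁ : (X → 𝔸) →ₗ[ℂ] (X → 𝔸)} {M G : Matrix X X ℝ}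
    (hO : O₁ = Ring.inverse Δ₁) (hMG : M * G = 1)
    (hΔ : ∀ (f : X → ℝ) (E : 𝔸), Δ₁ (liftY f E) = liftY (M *ᵥ f) E) (f : X → ℝ) (E : 𝔸) :
    O₁ (liftY f E) = liftY (G *ᵥ f) E :=
  have hM : IsUnit M := isUnit_iff_exists.2 ⟨G, hMG, mul_eq_one_comm.1 hMG⟩
  clause_of_leftInverse_mulVec (by rw [hO]; exact inverse_comp_self_of_liftY_clause_mulVec hM hΔ) hMG hΔ f E

/-- under the `Ring.inverse` hypotheses, the inverse letter IS the lift of the model inverse as an operator (endomorphism form): `O₁ = liftEndY S`.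
[cite: Balaban1985BackgroundPropagators, p.395 + Cor. 3.5 p.407, bookkeeping] -/
theorem eq_liftEndY_of_ringInverse [Fintype X] [DecidableEq X] {O₁ Δ₁ : (X → 𝔸) →ₗ[ℂ] (X → 𝔸)} {T S : Module.End ℝ (X → ℝ)}
    (hO : O₁ = Ring.inverse Δ₁) (hT : IsUnit T) (hTS : T ∘ₗ S = LinearMap.id)
    (hΔ : ∀ (f : X → ℝ) (E : 𝔸), Δ₁ (liftY f E) = liftY (T f) E) : O₁ = liftEndY 𝔸 S :=
  eq_liftEndY_of_liftY (clause_of_ringInverse hO hT hTS hΔ)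

/-- matrix form of `eq_liftEndY_of_ringInverse`: `O₁ = G♯`. [cite: Balaban1985BackgroundPropagators, pp.394–395 + Cor. 3.5 p.407, bookkeeping] -/
theorem eq_liftOpY_of_ringInverse [Fintype X] [DecidableEq X] {O₁ Δ₁ : (X → 𝔸) →ₗ[ℂ] (X → 𝔸)} {M G : Matrix X X ℝ}
    (hO : O₁ = Ring.inverse Δ₁) (hMG : M * G = 1)
    (hΔ : ∀ (f : X → ℝ) (E : 𝔸), Δ₁ (liftY f E) = liftY (M *ᵥ f) E) : O₁ = liftOpY 𝔸 G :=
  eq_liftOpY_of_liftY (clause_of_ringInverse_mulVec hO hMG hΔ)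

end Transfer

/-! ## §4 NODE 00's letters: `GA_one` ∕ `Gp_one` of an inverse letter from the `U = 1` clause of the direct operator -/

section Models

variable {d ℓ : ℕ} {hd : 1 ≤ d + 1} {hL : Odd (ℓ + 1) ∧ 1 < ℓ + 1} {b₀ b₁ : ℝ} (i : KIdx d ℓ hd hL b₀ b₁)

/-- r03's law `Δ_aG = 1` ([4] (2.22)) for the index, as linear maps on bond functions: `onFun Δ_a ∘ₗ Gop i = id`.
[cite: Balaban1984PropagatorsII, (2.19), (2.22) p.226] -/
theorem onFun_deltaAE_comp_Gop : onFun (deltaAE (domT i.hN i.D i.hk) i.cf i.w) ∘ₗ Gop i = LinearMap.id := by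
  have h := B6OpTransposeV1.onFun_deltaAE_mul_GE (domT i.hN i.D i.hk) i.hcf i.hw
  rwa [Module.End.mul_eq_comp, Module.End.one_eq_id] at h

/-- r03's `Δ_a` of the index, read on bond functions, is a unit (two-sided inverse `Gop i`). [cite: Balaban1984PropagatorsII, (2.22) p.226 («G = Δ_a⁻¹»)] -/
theorem isUnit_onFun_deltaAE : IsUnit (onFun (deltaAE (domT i.hN i.D i.hk) i.cf i.w)) :=
  isUnit_iff_exists.2 ⟨Gop i, B6OpTransposeV1.onFun_deltaAE_mul_GE (domT i.hN i.D i.hk) i.hcf i.hw,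
    B6Prop26KLevelSkeletonV1.onFun_GE_mul_deltaAE (domT i.hN i.D i.hk) i.hcf i.hw⟩

/-- `1 ≤ ℓ` for an index (from `4 ≤ ℓ`). [cite: Balaban1984PropagatorsII, (2.1) p.224, bookkeeping] -/
theorem one_le_ell (i : KIdx d ℓ hd hL b₀ b₁) : 1 ≤ ℓ := le_trans (by norm_num) i.hℓ

/-- T1's law `Δ′_a·G′ = 1` ([4] (2.13)–(2.14), p. 225) for NODE 00's torus index `toKT i` with the printed weights: `mlOpT … (aPrinted ℓ 1) * KTIdx.G = 1`.
[cite: Balaban1984PropagatorsII, p.225 («G′ = Δ′_a^{−1} is a well defined … operator»)] -/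
theorem mlOpT_mul_G : mlOpT (toKT i).NB ℓ (toKT i).k (toKT i).D.lev (aPrinted ℓ 1) * (toKT i).G = 1 :=
  mul_eq_one_comm.1 (B6Prop22MultiLevelTorus.gmlT_mul_mlOpT_pos (one_le_N0 (toKT i).hMh (toKT i).hP) (toKT i).D.one_le_lev
    (toKT i).D.lev_le (aPrinted_pos (one_le_ell i)))

/-- T1's `Δ′_a` of the torus index with the printed weights is a unit of the matrix ring. [cite: Balaban1984PropagatorsII, p.225 («G′ = Δ′_a^{−1}»)] -/
theorem isUnit_mlOpT : IsUnit (mlOpT (toKT i).NB ℓ (toKT i).k (toKT i).D.lev (aPrinted ℓ 1)) :=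
  isUnit_iff_exists.2 ⟨(toKT i).G, mlOpT_mul_G i, mul_eq_one_comm.1 (mlOpT_mul_G i)⟩

end Models

section Letters

variable [CompleteSpace 𝔸]
variable {d ℓ : ℕ} {hd : 1 ≤ d + 1} {hL : Odd (ℓ + 1) ∧ 1 < ℓ + 1} {b₀ b₁ : ℝ} (i : KIdx d ℓ hd hL b₀ b₁)

/-- ★ **`GA_one` OF AN INVERSE LETTER FROM THE `U = 1` CLAUSE OF THE DIRECT OPERATOR.**  For bond-sector letters `O` (the candidate G(U)) and `Δ` (the
candidate Δ_a(U)) with `O(1) ∘ Δ(1) = id` and the printed identification `Δ(1)(A ⊗ E) = (Δ_a A) ⊗ E` ([4] (2.19) read on bond functions: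
`onFun (deltaAE (domT i.hN i.D i.hk) i.cf i.w)`), G(1) acts on product forms as r03's `Gop i = Δ_a⁻¹`: the conclusion is the type of the interface field
`Node00.CovLettersY.GA_one` literally. [cite: Balaban1985BackgroundPropagators, p.395 («It coincides with Δ_a in (2.19) if U = 1», «G(U) = Δ_a(U)⁻¹») + Cor. 3.5 p.407] -/
theorem GA_one_of_deltaA_one (O Δ : BondOpY 𝔸 i)
    (hinv : O (fun _ _ => 1) ∘ₗ Δ (fun _ _ => 1) = LinearMap.id)
    (hΔ : ∀ (A : FBondY i → ℝ) (E : 𝔸),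
      Δ (fun _ _ => 1) (liftY A E) = liftY (onFun (deltaAE (domT i.hN i.D i.hk) i.cf i.w) A) E) :
    ∀ (J : FBondY i → ℝ) (E : 𝔸), O (fun _ _ => 1) (liftY J E) = liftY (Gop i J) E :=
  fun J E => clause_of_leftInverse hinv (onFun_deltaAE_comp_Gop i) hΔ J E

/-- ★ **`GA_one` FOR `G(U) := Ring.inverse (Δ_a(U))`** (def-Y's v2 shape, total in `Module.End ℂ`): the printed `U = 1` identification of Δ_a(U) on
product forms ALONE gives the interface field — `Δ(1)` is a unit because it lifts r03's bijective `Δ_a`.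
[cite: Balaban1985BackgroundPropagators, p.395 («It coincides with Δ_a in (2.19) if U = 1», «G(U) = Δ_a(U)⁻¹») + Cor. 3.5 p.407] -/
theorem GA_one_of_ringInverse_deltaA_one (O Δ : BondOpY 𝔸 i)
    (hO : O (fun _ _ => 1) = Ring.inverse (Δ (fun _ _ => 1)))
    (hΔ : ∀ (A : FBondY i → ℝ) (E : 𝔸),
      Δ (fun _ _ => 1) (liftY A E) = liftY (onFun (deltaAE (domT i.hN i.D i.hk) i.cf i.w) A) E) :
    ∀ (J : FBondY i → ℝ) (E : 𝔸), O (fun _ _ => 1) (liftY J E) = liftY (Gop i J) E :=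
  fun J E => clause_of_ringInverse hO (isUnit_onFun_deltaAE i) (onFun_deltaAE_comp_Gop i) hΔ J E

/-- under the `Ring.inverse` shape, G(1) IS the lift of r03's `Gop i` as an operator — i.e. it equals the `GA` letter of def-Y's flat family
`Node00.covLettersY_flat` at every configuration. [cite: Balaban1985BackgroundPropagators, p.395 + Cor. 3.5 p.407, bookkeeping] -/
theorem eq_liftEndY_Gop_of_ringInverse (O Δ : BondOpY 𝔸 i)
    (hO : O (fun _ _ => 1) = Ring.inverse (Δ (fun _ _ => 1)))
    (hΔ : ∀ (A : FBondY i → ℝ) (E : 𝔸),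
      Δ (fun _ _ => 1) (liftY A E) = liftY (onFun (deltaAE (domT i.hN i.D i.hk) i.cf i.w) A) E) :
    O (fun _ _ => 1) = liftEndY 𝔸 (Gop i) :=
  eq_liftEndY_of_ringInverse hO (isUnit_onFun_deltaAE i) (onFun_deltaAE_comp_Gop i) hΔ

/-- the flat family's `GA` letter is that lift (so `eq_liftEndY_Gop_of_ringInverse` reads: G(1) = the flat G, for every member `x` with `x.toKIdx = i`).
[cite: Balaban1985BackgroundPropagators, p.395, bookkeeping] -/
theorem covLettersY_flat_GA {Mstar : ℕ} (x : B9PinMembersKLevelV1.MemberY d ℓ hd hL b₀ b₁ Mstar) (U : CfgY 𝔸 x.toKIdx) :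
    (covLettersY_flat 𝔸 x).GA U = liftEndY 𝔸 (Gop x.toKIdx) := rfl

/-- ★ **`Gp_one` OF AN INVERSE LETTER FROM THE `U = 1` CLAUSE OF Δ′_a(U)** (site sector): for `O` (the candidate G′(U)) and `Δ` (the candidate Δ′_a(U))
with `O(1) ∘ Δ(1) = id` and `Δ(1)(f ⊗ E) = (Δ′_a f) ⊗ E` (T1's `mlOpT … (aPrinted ℓ 1)` on NODE 00's box chart), G′(1) acts on product forms as NODE 00's
`KTIdx.G = Δ′_a⁻¹`: the conclusion is the type of `Node00.CovLettersY.Gp_one` literally.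
[cite: Balaban1985BackgroundPropagators, (3.24)–(3.25) pp.394–395 («G′(U) = Δ′_a(U)⁻¹») + Cor. 3.5 p.407; Balaban1984PropagatorsII, (2.13)–(2.14) p.225] -/
theorem Gp_one_of_deltaPrimeA_one (O Δ : SiteOpY 𝔸 i)
    (hinv : O (fun _ _ => 1) ∘ₗ Δ (fun _ _ => 1) = LinearMap.id)
    (hΔ : ∀ (f : SiteY i → ℝ) (E : 𝔸),
      Δ (fun _ _ => 1) (liftY f E) = liftY (mlOpT (toKT i).NB ℓ (toKT i).k (toKT i).D.lev (aPrinted ℓ 1) *ᵥ f) E) :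
    ∀ (f : SiteY i → ℝ) (E : 𝔸), O (fun _ _ => 1) (liftY f E) = liftY ((toKT i).G *ᵥ f) E :=
  fun f E => clause_of_leftInverse_mulVec hinv (mlOpT_mul_G i) hΔ f E

/-- ★ **`Gp_one` FOR `G′(U) := Ring.inverse (Δ′_a(U))`** (def-Y's v2 shape): the `U = 1` identification of Δ′_a(U) on product forms alone gives the field.
[cite: Balaban1985BackgroundPropagators, (3.24)–(3.25) pp.394–395 + Cor. 3.5 p.407; Balaban1984PropagatorsII, (2.13)–(2.14) p.225] -/
theorem Gp_one_of_ringInverse_deltaPrimeA_one (O Δ : SiteOpY 𝔸 i)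
    (hO : O (fun _ _ => 1) = Ring.inverse (Δ (fun _ _ => 1)))
    (hΔ : ∀ (f : SiteY i → ℝ) (E : 𝔸),
      Δ (fun _ _ => 1) (liftY f E) = liftY (mlOpT (toKT i).NB ℓ (toKT i).k (toKT i).D.lev (aPrinted ℓ 1) *ᵥ f) E) :
    ∀ (f : SiteY i → ℝ) (E : 𝔸), O (fun _ _ => 1) (liftY f E) = liftY ((toKT i).G *ᵥ f) E :=
  fun f E => clause_of_ringInverse_mulVec hO (mlOpT_mul_G i) hΔ f E

/-- under the `Ring.inverse` shape, G′(1) IS the lift `KTIdx.G♯` as an operator (the `Gp` letter of def-Y's flat family).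
[cite: Balaban1985BackgroundPropagators, pp.394–395 + Cor. 3.5 p.407, bookkeeping] -/
theorem eq_liftOpY_G_of_ringInverse (O Δ : SiteOpY 𝔸 i)
    (hO : O (fun _ _ => 1) = Ring.inverse (Δ (fun _ _ => 1)))
    (hΔ : ∀ (f : SiteY i → ℝ) (E : 𝔸),
      Δ (fun _ _ => 1) (liftY f E) = liftY (mlOpT (toKT i).NB ℓ (toKT i).k (toKT i).D.lev (aPrinted ℓ 1) *ᵥ f) E) :
    O (fun _ _ => 1) = liftOpY 𝔸 (toKT i).G :=
  eq_liftOpY_of_ringInverse hO (mlOpT_mul_G i) hΔ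

/-- the flat family's `Gp` letter is that lift. [cite: Balaban1985BackgroundPropagators, pp.394–395, bookkeeping] -/
theorem covLettersY_flat_Gp {Mstar : ℕ} (x : B9PinMembersKLevelV1.MemberY d ℓ hd hL b₀ b₁ Mstar) (U : CfgY 𝔸 x.toKIdx) :
    (covLettersY_flat 𝔸 x).Gp U = liftOpY 𝔸 (toKT x.toKIdx).G := rfl

end Letters

end Literature.MathematicalPhysics.QuantumFieldTheory.Balaban1983to89.B9Cor35AtOneInverseLetters
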